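import Summits.Ventures.LatticeQCDFlow.TrivializingMaps.PlaquetteDecorrelation

/-!
HONEST FRAMING: exact (Metropolis-corrected) sampling algorithms for lattice gauge theory; figures
of merit are autocorrelation/cost numbers at stated couplings and volumes; no continuum-physics
claim.

# HaarFibreAverages — FIBRE AND BLOCK AVERAGES UNDER `D[U] = ⊗_links Haar`: `∫ Φ dD = ∫ dD(U) ∫ dν(h)
# Φ(h ·_e U)` AND `∫ Φ dD = ∫ dD(U) ∫ dD(k) Φ((Λ.piecewise k 1) · U)`; PARAMETRIC FIBRE INTEGRALS ARE
# CONTINUOUS (lean-2 GEN-9, ours)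

Venture-side (OURS).  Cell `lqcd-flow` (pub-lqcd), unit `pub-lqcd-lean-2-g9`, 2026-08-22.  The
measure-theoretic plumbing of the `β ≠ 0` extensive variance floor of the Wilson action (sequels
`GibbsFibreVariance` → `GibbsVarianceFloor` → `WilsonVarianceFloorAllCouplings`), every compact second-
countable gauge group `G`: `D = trivialMeasure G d L`, `ν = haarProbability G`,
`h ·_e U := Pi.mulSingle e h · U` (left multiplication of the link `e` by `h`).

* `trivialMeasure_isMulLeftInvariant / _isMulRightInvariant / _isProbabilityMeasure`;
* `continuous_integral_param` — `U ↦ ∫ F(U, y) dμ(y)` is continuous for jointly continuous `F` on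
  `G^E × Y`, `Y` compact, `μ` finite (Mathlib's `continuous_parametric_integral_of_continuous`);
* **`integral_eq_integral_fibre`** — `∫ Φ dD = ∫ dD(U) ∫ dν(h) Φ(h ·_e U)` (left invariance + Fubini);
* **`integral_eq_integral_block`** — `∫ Φ dD = ∫ dD(U) ∫ dD(k) Φ((Λ.piecewise k 1) · U)` for every finite
  set of links `Λ` (the configuration `k` on `Λ`, `1` elsewhere, `k ∼ D`).

NOT CLAIMED: anything beyond continuous integrands.  Literature grade (cell rule): textbook measure
theory; new typing only.
-/

noncomputable section

open MeasureTheory ProbabilityTheory Filter Topology Set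
open Literature.MathematicalPhysics.QuantumFieldTheory
open Literature.MathematicalPhysics.QuantumFieldTheory.Luscher2010

namespace Summit.Ventures.LatticeQCDFlow.TrivializingMaps

variable {d L : ℕ} [NeZero L] {G : Type*} [Group G] [TopologicalSpace G] [IsTopologicalGroup G]
  [CompactSpace G] [MeasurableSpace G] [BorelSpace G] [SecondCountableTopology G]

/-! ## §1 Fibre and block averages under `D[U]` -/

section Fibre

omit [SecondCountableTopology G] in
/-- `D[U]` is a left-invariant probability measure on the compact group `G^E`. [folklore] -/
theorem trivialMeasure_isMulLeftInvariant : (trivialMeasure G d L).IsMulLeftInvariant := by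
  unfold trivialMeasure; infer_instance

omit [SecondCountableTopology G] in
/-- `D[U]` is right invariant (compact groups are unimodular, factor by factor). [folklore] -/
theorem trivialMeasure_isMulRightInvariant : (trivialMeasure G d L).IsMulRightInvariant := by
  unfold trivialMeasure; infer_instance

omit [SecondCountableTopology G] in
/-- `D[U]` is a probability measure. [folklore] -/
theorem trivialMeasure_isProbabilityMeasure : IsProbabilityMeasure (trivialMeasure G d L) := by
  unfold trivialMeasure; infer_instance

omit [NeZero L] [IsTopologicalGroup G] [CompactSpace G] [MeasurableSpace G] [BorelSpace G]
  [SecondCountableTopology G] in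
/-- `h ↦ mulSingle e h` is continuous into `G^E`. [folklore] -/
theorem continuous_mulSingle_link [DecidableEq (Edge d L)] (e : Edge d L) :
    Continuous fun h : G => (Pi.mulSingle e h : GaugeConfig d L G) :=
  continuous_mulSingle (A := fun _ : Edge d L => G) e

omit [NeZero L] [CompactSpace G] [MeasurableSpace G] [BorelSpace G] [SecondCountableTopology G] in
/-- `(h, U) ↦ h ·_e U = mulSingle e h · U` is continuous. [folklore] -/
theorem continuous_mulSingle_mul [DecidableEq (Edge d L)] (e : Edge d L) :
    Continuous fun q : G × GaugeConfig d L G => Pi.mulSingle e q.1 * q.2 :=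
  ((continuous_mulSingle_link (d := d) (L := L) e).comp continuous_fst).mul continuous_snd

omit [NeZero L] [CompactSpace G] [MeasurableSpace G] [BorelSpace G] [SecondCountableTopology G] in
/-- `h ↦ h ·_e U` is continuous. [folklore] -/
theorem continuous_mulSingle_mul_left [DecidableEq (Edge d L)] (e : Edge d L) (U : GaugeConfig d L G) :
    Continuous fun h : G => Pi.mulSingle e h * U :=
  (continuous_mulSingle_link (d := d) (L := L) e).mul continuous_const

omit [NeZero L] [TopologicalSpace G] [IsTopologicalGroup G] [CompactSpace G] [MeasurableSpace G]
  [BorelSpace G] [SecondCountableTopology G] in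
/-- Composition of two moves along the same fibre: `h ·_e (h₀ ·_e U) = (h h₀) ·_e U`. [folklore] -/
theorem mulSingle_mul_mulSingle_mul [DecidableEq (Edge d L)] (e : Edge d L) (h h₀ : G)
    (U : GaugeConfig d L G) :
    Pi.mulSingle e h * (Pi.mulSingle e h₀ * U) = Pi.mulSingle e (h * h₀) * U := by
  rw [← mul_assoc, ← Pi.mulSingle_mul]

omit [MeasurableSpace G] [BorelSpace G] in
/-- **Parametric fibre integrals of continuous functions are continuous**: for `F` continuous on
`G^E × Y` (`Y = G` or `G^E`, compact, `μ` finite) `U ↦ ∫ F(U, y) dμ(y)` is continuous. [folklore] -/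
theorem continuous_integral_param {Y : Type*} [TopologicalSpace Y] [CompactSpace Y] [MeasurableSpace Y]
    [OpensMeasurableSpace Y] (μ : Measure Y) [IsFiniteMeasure μ]
    {F : GaugeConfig d L G → Y → ℝ} (hF : Continuous (Function.uncurry F)) :
    Continuous fun U => ∫ y, F U y ∂μ := by
  have h := continuous_parametric_integral_of_continuous (μ := μ) hF isCompact_univ
  simp only [Measure.restrict_univ] at h
  exact h

/-- **Fibre average**: `∫ Φ dD = ∫ dD(U) ∫ dν(h) Φ(h ·_e U)` for continuous `Φ` (left invariance of
`D[U]` under `mulSingle e h`, Fubini over `ν ⊗ D`). [ours] -/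
theorem integral_eq_integral_fibre [DecidableEq (Edge d L)] (e : Edge d L)
    {Φ : GaugeConfig d L G → ℝ} (hΦ : Continuous Φ) :
    ∫ U, Φ U ∂(trivialMeasure G d L) =
      ∫ U, ∫ h, Φ (Pi.mulSingle e h * U) ∂(haarProbability G) ∂(trivialMeasure G d L) := by
  set D := trivialMeasure G d L with hD
  set ν := haarProbability G with hν
  haveI : D.IsMulLeftInvariant := trivialMeasure_isMulLeftInvariant
  haveI : IsProbabilityMeasure D := trivialMeasure_isProbabilityMeasure
  have hinv : ∀ h : G, ∫ U, Φ (Pi.mulSingle e h * U) ∂D = ∫ U, Φ U ∂D := fun h =>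
    integral_mul_left_eq_self (μ := D) Φ (Pi.mulSingle e h)
  have hcont : Continuous fun q : G × GaugeConfig d L G => Φ (Pi.mulSingle e q.1 * q.2) :=
    hΦ.comp (continuous_mulSingle_mul e)
  have hint : Integrable (Function.uncurry fun (h : G) (U : GaugeConfig d L G) =>
      Φ (Pi.mulSingle e h * U)) (ν.prod D) :=
    (BoundedContinuousFunction.mkOfCompact ⟨_, hcont⟩).integrable _
  calc ∫ U, Φ U ∂D = ∫ h, ∫ U, Φ U ∂D ∂ν := by
        rw [integral_const, smul_eq_mul, probReal_univ, one_mul]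
    _ = ∫ h, ∫ U, Φ (Pi.mulSingle e h * U) ∂D ∂ν :=
        integral_congr_ae (ae_of_all _ fun h => (hinv h).symm)
    _ = ∫ U, ∫ h, Φ (Pi.mulSingle e h * U) ∂ν ∂D := integral_integral_swap hint

omit [NeZero L] [CompactSpace G] [MeasurableSpace G] [BorelSpace G] [SecondCountableTopology G] in
/-- `(k, U) ↦ (Λ.piecewise k 1) · U` is continuous. [folklore] -/
theorem continuous_piecewise_mul (Λ : Finset (Edge d L)) :
    Continuous fun q : GaugeConfig d L G × GaugeConfig d L G => Λ.piecewise q.1 1 * q.2 := by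
  refine Continuous.mul ?_ continuous_snd
  refine continuous_pi fun e => ?_
  by_cases he : e ∈ Λ
  · simp only [Finset.piecewise_eq_of_mem _ _ _ he]
    exact (continuous_apply e).comp continuous_fst
  · simp only [Finset.piecewise_eq_of_notMem _ _ _ he]
    exact continuous_const

/-- **Block average**: `∫ Φ dD = ∫ dD(U) ∫ dD(k) Φ((Λ.piecewise k 1) · U)` for continuous `Φ` and every
finite set of links `Λ` (left invariance of `D[U]` under the configuration `k` on `Λ`, `1` elsewhere;
Fubini over `D ⊗ D`). [ours] -/
theorem integral_eq_integral_block (Λ : Finset (Edge d L)) {Φ : GaugeConfig d L G → ℝ}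
    (hΦ : Continuous Φ) :
    ∫ U, Φ U ∂(trivialMeasure G d L) =
      ∫ U, ∫ k, Φ (Λ.piecewise k 1 * U) ∂(trivialMeasure G d L) ∂(trivialMeasure G d L) := by
  set D := trivialMeasure G d L with hD
  haveI : D.IsMulLeftInvariant := trivialMeasure_isMulLeftInvariant
  haveI : IsProbabilityMeasure D := trivialMeasure_isProbabilityMeasure
  have hinv : ∀ k : GaugeConfig d L G, ∫ U, Φ (Λ.piecewise k 1 * U) ∂D = ∫ U, Φ U ∂D := fun k =>
    integral_mul_left_eq_self (μ := D) Φ (Λ.piecewise k 1)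
  have hcont : Continuous fun q : GaugeConfig d L G × GaugeConfig d L G => Φ (Λ.piecewise q.1 1 * q.2) :=
    hΦ.comp (continuous_piecewise_mul Λ)
  have hint : Integrable (Function.uncurry fun (k U : GaugeConfig d L G) => Φ (Λ.piecewise k 1 * U))
      (D.prod D) :=
    (BoundedContinuousFunction.mkOfCompact ⟨_, hcont⟩).integrable _
  calc ∫ U, Φ U ∂D = ∫ k, ∫ U, Φ U ∂D ∂D := by
        rw [integral_const, smul_eq_mul, probReal_univ, one_mul]
    _ = ∫ k, ∫ U, Φ (Λ.piecewise k 1 * U) ∂D ∂D :=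
        integral_congr_ae (ae_of_all _ fun k => (hinv k).symm)
    _ = ∫ U, ∫ k, Φ (Λ.piecewise k 1 * U) ∂D ∂D := integral_integral_swap hint

end Fibre


end Summit.Ventures.LatticeQCDFlow.TrivializingMaps
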